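/-
Fleet lead `ym-wcr-19609-p1` (seat prover-ym-wcr-19609-p1-g2-0), route `WeakCouplingRates`, crux `BulkDominatesColdBoxW`
(stmt-QuantumFields-19609), line `dlr-chessboard` (v8): the DATUM PACKAGE — competitor coordinates repackaged in the ϑ-pass hypothesis shapes.
-/
import Summits.QuantumFields.YangMills.Theorems.WeakCouplingRatesBulkDominatesColdBoxWDatumCompetitorEventually
import Summits.QuantumFields.YangMills.Theorems.WeakCouplingRatesBulkDominatesColdBoxWFormMCongr
import Summits.QuantumFields.YangMills.Theorems.WeakCouplingRatesColdBoxGnomonicInverse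
import Summits.QuantumFields.YangMills.Theorems.WeakCouplingRatesColdBoxOneScaleDefs

/-!
# Crux `BulkDominatesColdBoxW`, expansion stubs: the datum package for the instantiation of T3/T4

`exists_datum_coords_energy_eventually` (p474139) charts the forest-fixed truncated gauge copy `W = forestFix H (glueWith E ((ω^g)|_E) 1)` of a
crude-good datum by coordinates `v` on the enlarged box `E`, with the energy clause of the interfaces.  The ϑ-pass theorems of seat ym-wcr-19608-p2
(`integral_cond_boxKernel_eq_integral_tilted_datum`, `abs_tiltWD_le_of_mem_goodTD`, …) want a datum `ϑ : Fin 3 → (ZdEdge 4 → ℝ)` with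
`W e = gnomonicChart (ϑ · e)` and `Σ_c ϑ c e² ≤ r²` for ALL `e ∉ Λ`, and `ϑ = 0` on the temporal forest.  `exists_datum_package_eventually` delivers
exactly that, by ZERO-EXTENDING `v` off `E ∖ Λ`: off `E` both `W` and `gnomonicChart 0` are `1`; on the forest `W = 1` forces `v = 0`
(`forestFix_forest`, `gnomonicChart_injective`), so the zero-extension agrees with `v` on every pinned edge of the enlarged box and the energy clause
transfers (`sum_formM_congr_pinned`).  No new definition; standard axioms.  NOT a claim about the mass gap.
-/

set_option autoImplicit false

noncomputable section

open Finset
open Literature.Probability.LatticeModels Literature.MathematicalPhysics.QuantumLattice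
open Literature.MathematicalPhysics.QuantumFieldTheory Literature.MathematicalPhysics.QuantumFieldTheory.AxialGauge
open Literature.MathematicalPhysics.QuantumFieldTheory.LatticeMaxwell

namespace Summit.QuantumFields.YangMills.Theorems.WeakCouplingRates

/-- **The datum package, eventually in `β`.**  For `0 < θ`, `0 ≤ δ`, `9θ + δ < 1/2` there is `β₀` such that for `β ≥ β₀`, `H = ⌈β^θ⌉`, every crude-good
`ω` admits a gauge `g` and a datum `ϑ` (colour-major) with, for `W = forestFix H (glueWith E ((ω^g)|_E) 1)`:
(1) `W e = gnomonicChart (ϑ · e)` for every `e ∉ Λ`; (2) `Σ_c (ϑ c e)² ≤ 2·278400²·β^{6θ+2δ−1}` for every `e ∉ Λ`; (3) `ϑ c (x,0) = 0` on the forest;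
(4) the energy clause `∃ s, Σ_c M_{ϑ_c}(s_c) ≤ 16(2H+3)⁴β^{2δ−1}`. -/
theorem exists_datum_package_eventually {θ δ : ℝ} (hθ : 0 < θ) (hδ : 0 ≤ δ) (hwin : 9 * θ + δ < 1 / 2) :
    ∃ β₀ : ℝ, ∀ β : ℝ, β₀ ≤ β → ∀ ω : LGConfig 4 (Matrix.specialUnitaryGroup (Fin 2) ℂ), CrudeGood β δ ⌈β ^ θ⌉₊ ω →
      ∃ (g : Site 4 → Matrix.specialUnitaryGroup (Fin 2) ℂ) (ϑ : Fin 3 → Literature.MathematicalPhysics.QuantumLattice.ZdEdge 4 → ℝ),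
        (∀ e, e ∉ boxEdges 4 (2 * ⌈β ^ θ⌉₊ + 1) →
          forestFix ⌈β ^ θ⌉₊ (glueWith (boxEdgesAt dirCorner (2 * ⌈β ^ θ⌉₊ + 3))
            (fun e' : ↥(boxEdgesAt dirCorner (2 * ⌈β ^ θ⌉₊ + 3)) => gaugeTransformZd g ω e'.1) (fun _ => 1)) e =
            gnomonicChart (fun c => ϑ c e)) ∧
        (∀ e, e ∉ boxEdges 4 (2 * ⌈β ^ θ⌉₊ + 1) → ∑ c, ϑ c e ^ 2 ≤ 2 * 278400 ^ 2 * β ^ (6 * θ + 2 * δ - 1)) ∧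
        (∀ x : Site 4, (∀ k : Fin 4, 1 ≤ x k ∧ x k + 1 ≤ 2 * (⌈β ^ θ⌉₊ : ℤ)) → ∀ c, ϑ c (x, 0) = 0) ∧
        ∃ s : Fin 3 → DirFree ⌈β ^ θ⌉₊ → ℝ,
          ∑ c : Fin 3, formM (fun e => e ∉ dirFreeEdges ⌈β ^ θ⌉₊) dirCorner (2 * ⌈β ^ θ⌉₊ + 3) (ϑ c) (s c) ≤
            16 * (2 * (⌈β ^ θ⌉₊ : ℝ) + 3) ^ 4 * β ^ (2 * δ - 1) := by
  obtain ⟨β₀, hβ₀⟩ := exists_datum_coords_energy_eventually hθ hδ hwin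
  refine ⟨max β₀ 1, fun β hβ ω hω => ?_⟩
  have hb0 : β₀ ≤ β := (le_max_left _ _).trans hβ
  have hβ1 : (1 : ℝ) ≤ β := (le_max_right _ _).trans hβ
  have hβpos : 0 < β := by linarith only [hβ1]
  obtain ⟨g, v, h1, h2, h3⟩ := hβ₀ β hb0 ω hω
  set H : ℕ := ⌈β ^ θ⌉₊ with hHdef
  set E := boxEdgesAt dirCorner (2 * H + 3) with hE
  set Λ := boxEdges 4 (2 * H + 1) with hΛ
  -- the zero-extended datum
  refine ⟨g, fun c e => if e ∈ E ∧ e ∉ Λ then v e c else 0, ?_, ?_, ?_, ?_⟩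
  · -- (1) chart form off Λ
    intro e he
    by_cases heE : e ∈ E
    · have : (fun c => if e ∈ E ∧ e ∉ Λ then v e c else 0) = v e := by
        funext c; rw [if_pos ⟨heE, he⟩]
      rw [this]; exact h1 e heE
    · have : (fun c => if e ∈ E ∧ e ∉ Λ then v e c else 0) = 0 := by
        funext c; rw [if_neg (fun h => heE h.1)]; rfl
      rw [this, gnomonicChart_zero, forestFix_apply_of_not_mem_boxEdges _ he, glueWith_apply_not_mem _ _ _ heE]
  · -- (2) coordinate size off Λ
    intro e he
    by_cases heE : e ∈ E
    · have : ∑ c, (if e ∈ E ∧ e ∉ Λ then v e c else 0) ^ 2 = ∑ c, v e c ^ 2 :=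
        Finset.sum_congr rfl fun c _ => by rw [if_pos ⟨heE, he⟩]
      rw [this]; exact h2 e heE
    · have : ∑ c : Fin 3, (if e ∈ E ∧ e ∉ Λ then v e c else 0) ^ 2 = 0 :=
        Finset.sum_eq_zero fun c _ => by rw [if_neg (fun h => heE h.1)]; ring
      rw [this]; positivity
  · -- (3) zero on the forest (forest edges lie in Λ)
    intro x hx c
    have hmem : ((x, (0 : Fin 4)) : Literature.MathematicalPhysics.QuantumLattice.ZdEdge 4) ∈ Λ := by
      rw [hΛ, mem_boxEdges_iff]
      refine ⟨fun k => ⟨by have := (hx k).1; omega, by have := (hx k).2; push_cast; omega⟩, by have := (hx 0).2; push_cast; omega⟩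
    simp only [hmem, not_true_eq_false, and_false, if_false]
  · -- (4) energy clause: the zero-extension agrees with `v` on every pinned edge of the enlarged box
    refine ⟨fun c e' => v e'.1.1 c, ?_⟩
    have hcongr : ∑ c : Fin 3, formM (fun e => e ∉ dirFreeEdges H) dirCorner (2 * H + 3)
        (fun e => if e ∈ E ∧ e ∉ Λ then v e c else 0) (fun e' => v e'.1.1 c) =
        ∑ c : Fin 3, formM (fun e => e ∉ dirFreeEdges H) dirCorner (2 * H + 3) (fun e => v e c) (fun e' => v e'.1.1 c) := by
      refine sum_formM_congr_pinned (fun c e he hpin => ?_) _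
      by_cases heΛ : e ∈ Λ
      · -- pinned and in Λ ⇒ forest edge ⇒ `v e = 0`
        rw [if_neg (fun h => h.2 heΛ)]
        obtain ⟨x, i⟩ := e
        have hforest : i = 0 ∧ ∀ k : Fin 4, 1 ≤ x k ∧ x k + 1 ≤ 2 * (H : ℤ) := by
          by_contra hnf
          exact hpin (mem_dirFreeEdges.2 ⟨heΛ, by exact_mod_cast hnf⟩)
        obtain ⟨hi, hx⟩ := hforest
        subst hi
        have hv0 : v (x, 0) = 0 := by
          apply gnomonicChart_injective
          rw [gnomonicChart_zero, ← h1 _ he]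
          exact forestFix_forest _ hx
        rw [hv0]; rfl
      · rw [if_pos ⟨he, heΛ⟩]
    rw [hcongr]
    exact h3

end Summit.QuantumFields.YangMills.Theorems.WeakCouplingRates

end
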